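import Literature.Geometry.Kaehler.LocalFormsGlue
import Mathlib.Data.Finset.Max
import HarnessLib

/-!
# Germ Čech descent: a closed form that is a Čech–de Rham coboundary along a finite family of compact strata is exact near their union

Family `hodge` (support for P. Deligne, *Théorie de Hodge III* (1974), Prop. 8.2.7, along the
"principle of two types" route of P. Deligne, Ph. Griffiths, J. Morgan, D. Sullivan, *Real homotopy
theory of Kähler manifolds*, Invent. Math. 29 (1975), §§5–6, and Ph. Griffiths, W. Schmid, *Recent
developments in Hodge theory* (1975), §4); layer `Literature/Geometry/Manifold`.

This file is the TOPOLOGICAL half of the argument "a cohomology class on a compact Kähler manifold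
that dies on every component of a normal crossing divisor `E = ⋃ E_i` dies on a neighbourhood of
`E`": the `∂∂̄` zig-zag (`Literature.Algebra.Homology.DDbarCechZigzag`) produces, for a closed form
`α`, Čech cochains `η_q` of forms on the strata `E_J` with `d η₀ = α|`, `δ η_q = d η_{q+1}`; here we
prove that such a **tower** forces `α` to be EXACT ON AN OPEN NEIGHBOURHOOD of `⋃ E_i` — the
generalized Mayer–Vietoris principle (R. Bott, L. W. Tu, *Differential Forms in Algebraic Topology*
(1982), §8, Prop. 8.5 and Prop. 8.8) for the CLOSED cover `(E_i)` at the level of germs, by induction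
on the number of strata with the two-set gluing of forms (Bott–Tu Prop. 2.3; J. M. Lee, *Introduction
to Smooth Manifolds* (2013), Thm. 17.20 and pp. 449–450).

Everything is phrased for an ABSTRACT stratified system (`GermCechSystem`) on a `C^∞` manifold `M`:
compact subsets `K_i ⊆ M`; for every tuple `J` an `ℝ`-module `T_J` ("all forms on the stratum
`K_J = ⋂ K_{J m}`") with a differential `d`, functorial restrictions `res` along maps of tuples, and
restriction maps `r_J` from the (ungraded) forms of `M` (`UForm`: all degrees at once, with the
calculus `UForm.restr`, `UForm.D` of `Literature.Geometry.Kaehler.LocalForms` — forms on an open set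
are forms on `M` smooth on it and zero off it); `r_J` is local near `K_J`, commutes with `d`, and two
TAUTNESS properties hold (`taut₁`: a closed form near `K_J` whose restriction to the stratum is exact
is exact on a smaller neighbourhood; `taut₂`: every `d`-closed element of `T_J` is, up to a
`d`-boundary, the restriction of a closed form on any prescribed small neighbourhood) — in the
application these are de Rham's theorem on open sets plus the tautness of `E_J(ℂ) ⊆ X(ℂ)`
(Spanier Thm. 6.1.10). Tuples are `Fin p → ι`, the Čech differential is the full ordered one
(`cechδ`, Bott–Tu (8.4) / p. 93), and all hypotheses and conclusions only concern STRICTLY INCREASING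
tuples with values in a finite set `s` (`Adm s`).

* `UForm`, `UForm.restr`, `UForm.D`, `UForm.IsSmoothOn`, `UForm.IsExactOn` and their calculus;
  `UForm.exists_glue` (two-set gluing).
* `GermCechSystem`, `GermCechSystem.cechδ`, `GermCechSystem.link` (the system of the strata
  `K_a ∩ K_J`, `T'_J = T_{a ∷ J}`), `cechδ_cons` (the Čech differential at a tuple `a ∷ K` splits
  as the restriction from `K` minus the Čech differential of the link).
* **`GermCechSystem.exists_isExactOn_of_tower`** (the theorem, with the coherence data needed by
  the induction) and **`GermCechSystem.exists_isExactOn`** (the statement used downstream): from a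
  closed `α` near `⋃_{i ∈ s} K_i` and a tower `η` over `s`, an open `V ⊇ ⋃ K_i` and `τ` smooth on
  `V` with `dτ = α` on `V`.

No named facts; definitions are the bookkeeping structures above.

## References

* R. Bott, L. W. Tu, *Differential Forms in Algebraic Topology*, GTM 82 (1982), Prop. 2.3, §8
  (8.1)–(8.4), Prop. 8.5, Prop. 8.8. [BottTu1982Forms]
* J. M. Lee, *Introduction to Smooth Manifolds*, 2nd ed. (2013), Thm. 17.20, pp. 449–450.
  [LeeSmoothManifolds2013]
* P. Deligne, Ph. Griffiths, J. Morgan, D. Sullivan, Invent. Math. 29 (1975), §§5–6.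
  [DeligneGriffithsMorganSullivan1975]
* E. H. Spanier, *Algebraic Topology* (1966), Ch. 6 §1 Thm. 10. [Spanier1981]
-/

noncomputable section

open scoped Manifold ContDiff Topology
open Set Filter Literature.Geometry.Kaehler

namespace Literature.Geometry.Manifold

universe w

variable {E : Type*} [NormedAddCommGroup E] [NormedSpace ℝ E]
  {H : Type*} [TopologicalSpace H] {I : ModelWithCorners ℝ E H}
  {M : Type*} [TopologicalSpace M] [ChartedSpace H M]
  {F : Type*} [NormedAddCommGroup F] [NormedSpace ℝ F]

/-! ### §1 Ungraded forms on open sets -/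

variable (I M F) in
/-- **Ungraded forms**: a form of every degree at once (`k ↦ α_k`). [folklore] -/
abbrev UForm : Type _ := ∀ k : ℕ, MForm I M F k

namespace UForm

/-- Restriction to `U`, extended by zero, degreewise (`MForm.restr`). [cite: BottTu1982Forms, §I.1] -/
def restr (U : Set M) (f : UForm I M F) : UForm I M F := fun k ↦ (f k).restr U

/-- The exterior derivative on the open set `U`, degreewise (`d_U α = (dα)|_U`, `localD`); the
degree-`0` component of `D f` is `0`. [cite: BottTu1982Forms, §I.1] -/
def D (U : Set M) (f : UForm I M F) : UForm I M F := fun k ↦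
  match k with
  | 0 => 0
  | k + 1 => (mextDeriv (f k)).restr U

/-- `f` is a form on `U` in every degree (smooth at the points of `U`, zero off `U`).
[cite: BottTu1982Forms, §I.1] -/
def IsSmoothOn (U : Set M) (f : UForm I M F) : Prop := ∀ k, f k ∈ smoothFormsOn I F U k

/-- `f` is exact on `U`: `f = D_U g` for a form `g` on `U`. [cite: BottTu1982Forms, §I.1] -/
def IsExactOn (U : Set M) (f : UForm I M F) : Prop := ∃ g : UForm I M F, IsSmoothOn U g ∧ D U g = f

/-- Unfolding of `restr` in a degree. [folklore] -/
@[simp] theorem restr_apply (U : Set M) (f : UForm I M F) (k : ℕ) : restr U f k = (f k).restr U := rfl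

/-- The degree-`0` component of `D` vanishes. [folklore] -/
@[simp] theorem D_zero_apply (U : Set M) (f : UForm I M F) : D U f 0 = 0 := rfl

/-- Unfolding of `D` in positive degree. [folklore] -/
@[simp] theorem D_succ_apply (U : Set M) (f : UForm I M F) (k : ℕ) :
    D U f (k + 1) = (mextDeriv (f k)).restr U := rfl

/-! #### Algebra of `restr` -/

/-- `restr` is additive. [folklore] -/
theorem restr_add (U : Set M) (f g : UForm I M F) : restr U (f + g) = restr U f + restr U g :=
  funext fun k ↦ MForm.restr_add U (f k) (g k)

/-- `restr` respects subtraction. [folklore] -/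
theorem restr_sub (U : Set M) (f g : UForm I M F) : restr U (f - g) = restr U f - restr U g :=
  funext fun k ↦ MForm.restr_sub U (f k) (g k)

/-- `restr` respects negation. [folklore] -/
theorem restr_neg (U : Set M) (f : UForm I M F) : restr U (-f) = -restr U f :=
  funext fun k ↦ MForm.restr_neg U (f k)

/-- `restr` is homogeneous. [folklore] -/
theorem restr_smul (U : Set M) (c : ℝ) (f : UForm I M F) : restr U (c • f) = c • restr U f :=
  funext fun k ↦ MForm.restr_smul U c (f k)

/-- `restr` of zero. [folklore] -/
@[simp] theorem restr_zero (U : Set M) : restr U (0 : UForm I M F) = 0 :=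
  funext fun _ ↦ MForm.restr_zero U

/-- Restricting twice is restricting to the smaller set. [folklore] -/
theorem restr_restr_of_subset {U V : Set M} (h : U ⊆ V) (f : UForm I M F) :
    restr U (restr V f) = restr U f :=
  funext fun k ↦ MForm.restr_restr_of_subset h (f k)

/-- Restricting twice to the same set. [folklore] -/
theorem restr_restr_self (U : Set M) (f : UForm I M F) : restr U (restr U f) = restr U f :=
  restr_restr_of_subset Subset.rfl f

/-- Restriction to the empty set is zero. [folklore] -/
@[simp] theorem restr_empty (f : UForm I M F) : restr (∅ : Set M) f = 0 :=
  funext fun _ ↦ funext fun x ↦ MForm.restr_apply_of_notMem _ (notMem_empty x)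

/-- On `U` the restriction is the form. [folklore] -/
theorem restr_apply_of_mem {U : Set M} (f : UForm I M F) (k : ℕ) {x : M} (hx : x ∈ U) :
    restr U f k x = f k x :=
  MForm.restr_apply_of_mem _ hx

/-- Off `U` the restriction vanishes. [folklore] -/
theorem restr_apply_of_notMem {U : Set M} (f : UForm I M F) (k : ℕ) {x : M} (hx : x ∉ U) :
    restr U f k x = 0 :=
  MForm.restr_apply_of_notMem _ hx

/-- Two ungraded forms vanishing off `U` and agreeing on `U` are equal. [folklore] -/
theorem eq_of_restr_eq {U : Set M} {f g : UForm I M F} (hf : restr U f = f) (hg : restr U g = g)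
    (h : ∀ k, ∀ x ∈ U, f k x = g k x) : f = g := by
  rw [← hf, ← hg]
  funext k x
  by_cases hx : x ∈ U
  · rw [restr_apply_of_mem f k hx, restr_apply_of_mem g k hx, h k x hx]
  · rw [restr_apply_of_notMem f k hx, restr_apply_of_notMem g k hx]

/-- A form on the union of two sets is determined by its restrictions to them. [folklore] -/
theorem eq_of_restr_eq_of_restr_eq {P Q : Set M} {f g : UForm I M F} (hf : restr (P ∪ Q) f = f)
    (hg : restr (P ∪ Q) g = g) (hP : restr P f = restr P g) (hQ : restr Q f = restr Q g) : f = g := by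
  refine eq_of_restr_eq hf hg fun k x hx ↦ ?_
  rcases hx with hx | hx
  · have := congrArg (fun u : UForm I M F ↦ u k x) hP
    simpa [restr_apply_of_mem _ k hx] using this
  · have := congrArg (fun u : UForm I M F ↦ u k x) hQ
    simpa [restr_apply_of_mem _ k hx] using this

/-! #### Algebra of `D` -/

/-- `D` is homogeneous. [folklore] -/
theorem D_smul (U : Set M) (c : ℝ) (f : UForm I M F) : D U (c • f) = c • D U f := by
  funext k
  cases k with
  | zero => simp
  | succ k =>
    change (mextDeriv (c • f k)).restr U = c • (mextDeriv (f k)).restr U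
    rw [mextDeriv_smul, MForm.restr_smul]

/-- `D` of zero. [folklore] -/
@[simp] theorem D_zero (U : Set M) : D U (0 : UForm I M F) = 0 := by
  funext k
  cases k with
  | zero => rfl
  | succ k =>
    change (mextDeriv (0 : MForm I M F k)).restr U = 0
    rw [mextDeriv_zero, MForm.restr_zero]

/-- `D` respects negation. [folklore] -/
theorem D_neg (U : Set M) (f : UForm I M F) : D U (-f) = -D U f := by
  rw [← neg_one_smul ℝ f, D_smul, neg_one_smul]

/-- `D_U` is additive on forms smooth at the points of `U`. [folklore] -/
theorem D_add {U : Set M} {f g : UForm I M F} (hf : ∀ k, ∀ x ∈ U, (f k).SmoothAt x)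
    (hg : ∀ k, ∀ x ∈ U, (g k).SmoothAt x) : D U (f + g) = D U f + D U g := by
  funext k
  cases k with
  | zero => simp
  | succ k =>
    funext x
    change (mextDeriv (f k + g k)).restr U x =
      (mextDeriv (f k)).restr U x + (mextDeriv (g k)).restr U x
    by_cases hx : x ∈ U
    · rw [MForm.restr_apply_of_mem _ hx, MForm.restr_apply_of_mem _ hx,
        MForm.restr_apply_of_mem _ hx]
      exact mextDeriv_add_apply (hf k x hx) (hg k x hx)
    · simp [MForm.restr_apply_of_notMem _ hx]

/-- `D` respects subtraction on smooth forms. [folklore] -/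
theorem D_sub {U : Set M} {f g : UForm I M F} (hf : ∀ k, ∀ x ∈ U, (f k).SmoothAt x)
    (hg : ∀ k, ∀ x ∈ U, (g k).SmoothAt x) : D U (f - g) = D U f - D U g := by
  rw [sub_eq_add_neg, D_add hf (fun k x hx ↦ ?_), D_neg, ← sub_eq_add_neg]
  exact (hg k x hx).neg

/-- `D_U` only sees the form on `U`: `D_U (f|_V) = D_U f` for open `V ⊇ U`. [folklore] -/
theorem D_restr_of_subset {U V : Set M} (hV : IsOpen V) (hUV : U ⊆ V) (f : UForm I M F) :
    D U (restr V f) = D U f := by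
  funext k
  cases k with
  | zero => rfl
  | succ k =>
    funext x
    change (mextDeriv ((f k).restr V)).restr U x = (mextDeriv (f k)).restr U x
    by_cases hx : x ∈ U
    · rw [MForm.restr_apply_of_mem _ hx, MForm.restr_apply_of_mem _ hx,
        mextDeriv_restr_apply hV _ (hUV hx)]
    · rw [MForm.restr_apply_of_notMem _ hx, MForm.restr_apply_of_notMem _ hx]

/-- `D_U (f|_U) = D_U f`. [folklore] -/
theorem D_restr_self {U : Set M} (hU : IsOpen U) (f : UForm I M F) : D U (restr U f) = D U f :=
  D_restr_of_subset hU Subset.rfl f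

/-- Restricting `D_V f` to `U ⊆ V` gives `D_U f`. [folklore] -/
theorem restr_D_of_subset {U V : Set M} (hUV : U ⊆ V) (f : UForm I M F) :
    restr U (D V f) = D U f := by
  funext k
  cases k with
  | zero => exact MForm.restr_zero U
  | succ k => exact MForm.restr_restr_of_subset hUV _

/-- `(D_U f)|_U = D_U f`. [folklore] -/
theorem restr_D_self (U : Set M) (f : UForm I M F) : restr U (D U f) = D U f :=
  restr_D_of_subset Subset.rfl f

/-- Locality of `D`: forms agreeing on an open `U` have the same `D_U`. [folklore] -/
theorem D_congr {U : Set M} (hU : IsOpen U) {f g : UForm I M F} (h : ∀ k, ∀ x ∈ U, f k x = g k x) :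
    D U f = D U g := by
  have : restr U f = restr U g := by
    funext k x
    by_cases hx : x ∈ U
    · rw [restr_apply_of_mem f k hx, restr_apply_of_mem g k hx, h k x hx]
    · rw [restr_apply_of_notMem f k hx, restr_apply_of_notMem g k hx]
  rw [← D_restr_self hU f, this, D_restr_self hU g]

/-! #### Smoothness -/

/-- A form on `U` is smooth at the points of `U`. [folklore] -/
theorem IsSmoothOn.smoothAt {U : Set M} {f : UForm I M F} (hf : IsSmoothOn U f) (k : ℕ) {x : M}
    (hx : x ∈ U) : (f k).SmoothAt x :=
  (hf k).1 x hx

/-- A form on `U` is its own restriction to `U`. [folklore] -/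
theorem IsSmoothOn.restr_eq {U : Set M} {f : UForm I M F} (hf : IsSmoothOn U f) : restr U f = f :=
  funext fun k ↦ MForm.restr_eq_self (hf k).2

/-- Zero is a form on every set. [folklore] -/
theorem isSmoothOn_zero (U : Set M) : IsSmoothOn U (0 : UForm I M F) := fun _ ↦ Submodule.zero_mem _

/-- Forms on `U` are stable under addition. [folklore] -/
theorem IsSmoothOn.add {U : Set M} {f g : UForm I M F} (hf : IsSmoothOn U f) (hg : IsSmoothOn U g) :
    IsSmoothOn U (f + g) := fun k ↦ Submodule.add_mem _ (hf k) (hg k)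

/-- Forms on `U` are stable under subtraction. [folklore] -/
theorem IsSmoothOn.sub {U : Set M} {f g : UForm I M F} (hf : IsSmoothOn U f) (hg : IsSmoothOn U g) :
    IsSmoothOn U (f - g) := fun k ↦ Submodule.sub_mem _ (hf k) (hg k)

/-- Forms on `U` are stable under negation. [folklore] -/
theorem IsSmoothOn.neg {U : Set M} {f : UForm I M F} (hf : IsSmoothOn U f) : IsSmoothOn U (-f) :=
  fun k ↦ Submodule.neg_mem _ (hf k)

/-- Forms on `U` are stable under scalars. [folklore] -/
theorem IsSmoothOn.smul {U : Set M} {f : UForm I M F} (c : ℝ) (hf : IsSmoothOn U f) :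
    IsSmoothOn U (c • f) := fun k ↦ Submodule.smul_mem _ c (hf k)

/-- Restriction of a form on `V` to an open `U ⊆ V` is a form on `U`. [folklore] -/
theorem IsSmoothOn.restr {U V : Set M} (hU : IsOpen U) (hUV : U ⊆ V) {f : UForm I M F}
    (hf : IsSmoothOn V f) : IsSmoothOn U (restr U f) :=
  fun k ↦ restr_mem_smoothFormsOn hU hUV (hf k)

/-- A smooth function (at the points of `U`) times a form on `U` is a form on `U`. [folklore] -/
theorem IsSmoothOn.fun_smul {U : Set M} {ρ : M → ℝ} (hρ : ∀ x ∈ U, ContMDiffAt I 𝓘(ℝ) ∞ ρ x)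
    {f : UForm I M F} (hf : IsSmoothOn U f) : IsSmoothOn U (ρ • f) :=
  fun k ↦ fun_smul_mem_smoothFormsOn hρ (hf k)

section Deriv

variable [IsManifold I ∞ M]

/-- `D_U` of a form on `U` is a form on `U`. [folklore] -/
theorem IsSmoothOn.D {U : Set M} (hU : IsOpen U) {f : UForm I M F} (hf : IsSmoothOn U f) :
    IsSmoothOn U (D U f) := fun k ↦ by
  cases k with
  | zero => exact Submodule.zero_mem _
  | succ k => exact restr_mextDeriv_mem hU (hf k)

/-- `D_U ∘ D_U = 0` on forms on `U`. [cite: BottTu1982Forms, §I.1] -/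
theorem D_D {U : Set M} (hU : IsOpen U) {f : UForm I M F} (hf : IsSmoothOn U f) : D U (D U f) = 0 := by
  funext k
  cases k with
  | zero => rfl
  | succ k =>
    cases k with
    | zero =>
      change (mextDeriv (0 : MForm I M F 0)).restr U = 0
      rw [mextDeriv_zero, MForm.restr_zero]
    | succ k =>
      have := localD_localD (I := I) (F := F) (k := k) hU ⟨f k, hf k⟩
      have h2 := congrArg Subtype.val this
      simpa [coe_localD] using h2

/-- An exact form is closed (on an open set). [cite: BottTu1982Forms, §I.1] -/
theorem IsExactOn.D_eq_zero {U : Set M} (hU : IsOpen U) {f : UForm I M F} (hf : IsExactOn U f) :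
    D U f = 0 := by
  obtain ⟨g, hg, rfl⟩ := hf
  exact D_D hU hg

/-- An exact form on `U` is a form on `U`. [folklore] -/
theorem IsExactOn.isSmoothOn {U : Set M} (hU : IsOpen U) {f : UForm I M F} (hf : IsExactOn U f) :
    IsSmoothOn U f := by
  obtain ⟨g, hg, rfl⟩ := hf
  exact hg.D hU

omit [IsManifold I ∞ M] in
/-- Exactness restricts to smaller open sets. [cite: BottTu1982Forms, §I.1] -/
theorem IsExactOn.restr {U V : Set M} (hU : IsOpen U) (hUV : U ⊆ V) {f : UForm I M F}
    (hf : IsExactOn V f) : IsExactOn U (restr U f) := by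
  obtain ⟨g, hg, rfl⟩ := hf
  exact ⟨UForm.restr U g, hg.restr hU hUV, by rw [D_restr_self hU, restr_D_of_subset hUV]⟩

omit [IsManifold I ∞ M] in
/-- `D` of a form on `V` restricted to `U ⊆ V`: `(D_V τ)|_U = D_U (τ|_U)`. [folklore] -/
theorem restr_D_eq_D_restr {U V : Set M} (hU : IsOpen U) (hUV : U ⊆ V) (τ : UForm I M F) :
    restr U (D V τ) = D U (restr U τ) := by
  rw [restr_D_of_subset hUV, D_restr_self hU]

end Deriv

/-! #### Two-set gluing -/

/-- **Gluing ungraded forms**: forms `u` on `P` and `v` on `Q` (open) agreeing on `P ∩ Q` are the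
restrictions of a form on `P ∪ Q` (Bott–Tu Prop. 2.3, degreewise `MForm.glue`). [cite: BottTu1982Forms, Prop. 2.3] -/
theorem exists_glue {P Q : Set M} (hP : IsOpen P) (hQ : IsOpen Q) {u v : UForm I M F}
    (hu : IsSmoothOn P u) (hv : IsSmoothOn Q v) (huv : restr (P ∩ Q) u = restr (P ∩ Q) v) :
    ∃ τ : UForm I M F, IsSmoothOn (P ∪ Q) τ ∧ restr P τ = u ∧ restr Q τ = v := by
  have huv' : ∀ k, ∀ y ∈ P ∩ Q, u k y = v k y := fun k y hy ↦ by
    have := congrArg (fun f : UForm I M F ↦ f k y) huv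
    simpa [restr_apply_of_mem _ k hy] using this
  exact ⟨fun k ↦ MForm.glue P Q (u k) (v k),
    fun k ↦ glue_mem_smoothFormsOn hP hQ (hu k) (hv k) (huv' k),
    funext fun k ↦ MForm.restr_glue_left (hu k).2 (v k),
    funext fun k ↦ MForm.restr_glue_right (huv' k) (hv k).2⟩

end UForm

/-! ### §2 Tuples -/

namespace GermCech

/-- The lift `θ⁺ : Fin (p+1) → Fin (q+1)` of `θ : Fin p → Fin q` fixing `0` and shifting the rest
(`a ∷ (J ∘ θ) = (a ∷ J) ∘ θ⁺`). [folklore] -/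
def liftMap {p q : ℕ} (θ : Fin p → Fin q) : Fin (p + 1) → Fin (q + 1) :=
  Fin.cons 0 (Fin.succ ∘ θ)

/-- `θ⁺ 0 = 0`. [folklore] -/
@[simp] theorem liftMap_zero {p q : ℕ} (θ : Fin p → Fin q) : liftMap θ 0 = 0 := rfl

/-- `θ⁺ (i+1) = θ i + 1`. [folklore] -/
@[simp] theorem liftMap_succ {p q : ℕ} (θ : Fin p → Fin q) (i : Fin p) :
    liftMap θ i.succ = (θ i).succ := rfl

/-- `θ⁺ ∘ succ = succ ∘ θ`. [folklore] -/
theorem liftMap_comp_succ {p q : ℕ} (θ : Fin p → Fin q) : liftMap θ ∘ Fin.succ = Fin.succ ∘ θ := rfl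

/-- `(a ∷ J) ∘ θ⁺ = a ∷ (J ∘ θ)`. [folklore] -/
theorem cons_comp_liftMap {ι : Type*} {p q : ℕ} (a : ι) (J : Fin q → ι) (θ : Fin p → Fin q) :
    (Fin.cons a J : Fin (q + 1) → ι) ∘ liftMap θ = Fin.cons a (J ∘ θ) := by
  funext i
  refine Fin.cases rfl (fun j ↦ rfl) i

/-- `id⁺ = id`. [folklore] -/
theorem liftMap_id {p : ℕ} : liftMap (id : Fin p → Fin p) = id := by
  funext i
  refine Fin.cases rfl (fun j ↦ rfl) i

/-- `(θ ∘ θ')⁺ = θ⁺ ∘ θ'⁺`. [folklore] -/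
theorem liftMap_comp {p q m : ℕ} (θ : Fin p → Fin q) (θ' : Fin m → Fin p) :
    liftMap (θ ∘ θ') = liftMap θ ∘ liftMap θ' := by
  funext i
  refine Fin.cases rfl (fun j ↦ rfl) i

/-- The lift of a face map is the next face map. [folklore] -/
theorem liftMap_succAbove {p : ℕ} (b : Fin (p + 1)) :
    liftMap (Fin.succAbove b) = Fin.succAbove b.succ := by
  funext i
  refine Fin.cases ?_ (fun j ↦ ?_) i
  · simp [liftMap]
  · simp [liftMap, Fin.succ_succAbove_succ]

/-- The positive faces of `a ∷ K` are `a ∷ (faces of K)`. [folklore] -/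
theorem cons_comp_succAbove_succ {ι : Type*} {p : ℕ} (a : ι) (K : Fin (p + 1) → ι) (b : Fin (p + 1)) :
    (Fin.cons a K : Fin (p + 2) → ι) ∘ Fin.succAbove b.succ = Fin.cons a (K ∘ Fin.succAbove b) := by
  rw [← liftMap_succAbove, cons_comp_liftMap]

/-- The face map `σ₁ : Fin 1 → Fin 2` is the constant `0`. [folklore] -/
theorem succAbove_one_eq : (Fin.succAbove (1 : Fin 2) : Fin 1 → Fin 2) = fun _ ↦ 0 := by
  funext i
  fin_cases i
  rfl

/-- **Admissible tuples over `s`**: strictly increasing with values in `s`. [folklore] -/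
def Adm {ι : Type*} [Preorder ι] (s : Finset ι) {p : ℕ} (J : Fin p → ι) : Prop :=
  StrictMono J ∧ ∀ m, J m ∈ s

/-- Admissibility is monotone in the index set. [folklore] -/
theorem Adm.mono {ι : Type*} [Preorder ι] {s t : Finset ι} (hst : s ⊆ t) {p : ℕ} {J : Fin p → ι}
    (h : Adm s J) : Adm t J :=
  ⟨h.1, fun m ↦ hst (h.2 m)⟩

/-- A `1`-tuple is admissible iff its value lies in `s`. [folklore] -/
theorem adm_one_iff {ι : Type*} [Preorder ι] (s : Finset ι) (J : Fin 1 → ι) : Adm s J ↔ J 0 ∈ s := by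
  refine ⟨fun h ↦ h.2 0, fun h ↦ ⟨fun x y hxy ↦ ?_, fun m ↦ ?_⟩⟩
  · exact absurd hxy (by rw [Subsingleton.elim x y]; exact lt_irrefl _)
  · rwa [Subsingleton.elim m 0]

/-- Faces of admissible tuples are admissible. [folklore] -/
theorem Adm.comp_succAbove {ι : Type*} [Preorder ι] {s : Finset ι} {p : ℕ} {K : Fin (p + 1) → ι}
    (h : Adm s K) (b : Fin (p + 1)) : Adm s (K ∘ Fin.succAbove b) :=
  ⟨h.1.comp (Fin.strictMono_succAbove b), fun _ ↦ h.2 _⟩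

/-- `a ∷ L` is admissible over `insert a s'` when `L` is admissible over `s'` and `a < s'`. [folklore] -/
theorem adm_cons {ι : Type*} [LinearOrder ι] {s' : Finset ι} {a : ι} (ha : ∀ x ∈ s', a < x) {p : ℕ}
    {L : Fin (p + 1) → ι} (hL : Adm s' L) : Adm (insert a s') (Fin.cons a L : Fin (p + 2) → ι) := by
  refine ⟨(Fin.strictMono_iff_lt_succ).2 fun i ↦ ?_, fun m ↦ ?_⟩
  · refine Fin.cases ?_ (fun j ↦ ?_) i
    · exact ha _ (hL.2 0)
    · change (Fin.cons a L : Fin (p + 2) → ι) j.succ.castSucc < L j.succ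
      rw [show (j.succ.castSucc : Fin (p + 2)) = j.castSucc.succ from rfl]
      exact hL.1 Fin.castSucc_lt_succ
  · exact Fin.cases (Finset.mem_insert_self a s') (fun j ↦ Finset.mem_insert_of_mem (hL.2 j)) m

/-- The tail of an admissible tuple starting with `a` is admissible over the rest. [folklore] -/
theorem adm_tail_of_cons {ι : Type*} [LinearOrder ι] {s' : Finset ι} {a : ι} {p : ℕ}
    {L : Fin (p + 1) → ι} (h : Adm (insert a s') (Fin.cons a L : Fin (p + 2) → ι)) : Adm s' L := by
  refine ⟨fun x y hxy ↦ h.1 (Fin.succ_lt_succ_iff.2 hxy), fun m ↦ ?_⟩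
  have hlt : a < L m := by
    have := h.1 (Fin.succ_pos m)
    simpa using this
  have hm := h.2 m.succ
  simp only [Fin.cons_succ, Finset.mem_insert] at hm
  exact hm.resolve_left (ne_of_gt hlt)

/-- An admissible tuple over `insert a s'` (`a < s'`) not starting with `a` is admissible over `s'`.
[folklore] -/
theorem adm_of_cons_ne {ι : Type*} [LinearOrder ι] {s' : Finset ι} {a : ι} (ha : ∀ x ∈ s', a < x)
    {p : ℕ} {j : ι} {L : Fin p → ι} (hj : j ≠ a)
    (h : Adm (insert a s') (Fin.cons j L : Fin (p + 1) → ι)) :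
    Adm s' (Fin.cons j L : Fin (p + 1) → ι) := by
  refine ⟨h.1, fun m ↦ ?_⟩
  have hj' : j ∈ s' := by
    have := h.2 0
    simp only [Fin.cons_zero, Finset.mem_insert] at this
    exact this.resolve_left hj
  have hm := h.2 m
  rw [Finset.mem_insert] at hm
  rcases hm with hm | hm
  · exfalso
    have h0m : (Fin.cons j L : Fin (p + 1) → ι) 0 ≤ (Fin.cons j L : Fin (p + 1) → ι) m :=
      h.1.monotone (Fin.zero_le m)
    rw [hm, Fin.cons_zero] at h0m
    exact absurd (ha j hj') (not_lt.2 h0m)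
  · exact hm

/-- An admissible `1`-tuple not starting with `a` lies in `s'`. [folklore] -/
theorem adm_one_of_ne {ι : Type*} [LinearOrder ι] {s' : Finset ι} {a : ι} {J : Fin 1 → ι}
    (hj : J 0 ≠ a) (h : Adm (insert a s') J) : Adm s' J := by
  rw [adm_one_iff] at h ⊢
  exact (Finset.mem_insert.1 h).resolve_left hj

end GermCech

open GermCech

/-! ### §3 Germ Čech systems -/

variable (I M F) in
/-- **A germ Čech system** on `M` indexed by `ι`: compact `K_i ⊆ M`; for every tuple `J` an
`ℝ`-module `T_J` (the forms on the stratum `K_J = ⋂ K_{J m}`) with a differential `d_J`;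
restrictions `res` along maps of tuples `θ` (from `T_{J ∘ θ}` to `T_J`, `K_J ⊆ K_{J ∘ θ}`),
functorial and commuting with `d`; restriction `r_J` of the ambient (ungraded) forms to every
stratum (a bare function, additive on forms smooth near `K_J`), compatible with `res`, local near
`K_J` and commuting with `d`; and the two tautness
properties of the strata: (`taut₁`) a closed form near `K_J` whose restriction to the stratum is a
`d`-boundary is exact on a smaller neighbourhood, (`taut₂`) every `d`-cycle of `T_J` is, up to a
`d`-boundary, the restriction of a closed form living on an arbitrarily small neighbourhood of `K_J`
(de Rham's theorem on open sets and the tautness of compact ENR pairs, Spanier Thm. 6.1.10, in the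
application). [cite: BottTu1982Forms, §8 (8.1)–(8.4)] [cite: Spanier1981, Ch. 6 §1 Thm. 10] -/
structure GermCechSystem (ι : Type*) where
  /-- the compact pieces -/
  K : ι → Set M
  /-- they are compact -/
  isCompact_K : ∀ i, IsCompact (K i)
  /-- the forms on the stratum `K_J` -/
  T : ∀ ⦃p : ℕ⦄, (Fin p → ι) → Type w
  /-- additive structure -/
  [instAddCommGroup : ∀ ⦃p : ℕ⦄ (J : Fin p → ι), AddCommGroup (T J)]
  /-- `ℝ`-module structure -/
  [instModule : ∀ ⦃p : ℕ⦄ (J : Fin p → ι), Module ℝ (T J)]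
  /-- restriction along a map of tuples -/
  res : ∀ ⦃p q : ℕ⦄ (J' : Fin p → ι) (J : Fin q → ι) (θ : Fin p → Fin q), J' = J ∘ θ →
    (T J' →ₗ[ℝ] T J)
  /-- the differential on the stratum -/
  d : ∀ ⦃p : ℕ⦄ (J : Fin p → ι), T J →ₗ[ℝ] T J
  /-- restriction of ambient forms to the stratum (a bare function: in the application, pull-back
  of forms, additive only on forms smooth near the stratum) -/
  r : ∀ ⦃p : ℕ⦄ (J : Fin p → ι), UForm I M F → T J
  /-- restriction along (a map equal to) the identity is the identity -/
  res_self : ∀ ⦃p : ℕ⦄ (J : Fin p → ι) (θ : Fin p → Fin p) (h : J = J ∘ θ), θ = id →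
    ∀ z, res J J θ h z = z
  /-- restriction is functorial -/
  res_res : ∀ ⦃p q m : ℕ⦄ (J'' : Fin m → ι) (J' : Fin p → ι) (J : Fin q → ι) (θ : Fin p → Fin q)
    (θ' : Fin m → Fin p) (h : J' = J ∘ θ) (h' : J'' = J' ∘ θ') (h'' : J'' = J ∘ (θ ∘ θ')) (z : T J''),
    res J' J θ h (res J'' J' θ' h' z) = res J'' J (θ ∘ θ') h'' z
  /-- restriction commutes with `d` -/
  res_d : ∀ ⦃p q : ℕ⦄ (J' : Fin p → ι) (J : Fin q → ι) (θ : Fin p → Fin q) (h : J' = J ∘ θ)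
    (z : T J'), res J' J θ h (d J' z) = d J (res J' J θ h z)
  /-- restriction of ambient forms smooth near the larger stratum is compatible with `res` -/
  res_r : ∀ ⦃p q : ℕ⦄ (J' : Fin (p + 1) → ι) (J : Fin q → ι) (θ : Fin (p + 1) → Fin q)
    (h : J' = J ∘ θ) {W : Set M}, IsOpen W → (⋂ m, K (J' m)) ⊆ W →
    ∀ {f : UForm I M F}, (∀ k, ∀ x ∈ W, (f k).SmoothAt x) → res J' J θ h (r J' f) = r J f
  /-- restriction of ambient forms is additive on forms smooth near the stratum -/
  r_add : ∀ ⦃p : ℕ⦄ (J : Fin (p + 1) → ι) {W : Set M}, IsOpen W → (⋂ m, K (J m)) ⊆ W →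
    ∀ {f g : UForm I M F}, (∀ k, ∀ x ∈ W, (f k).SmoothAt x) → (∀ k, ∀ x ∈ W, (g k).SmoothAt x) →
      r J (f + g) = r J f + r J g
  /-- restriction of ambient forms respects differences of forms smooth near the stratum -/
  r_sub : ∀ ⦃p : ℕ⦄ (J : Fin (p + 1) → ι) {W : Set M}, IsOpen W → (⋂ m, K (J m)) ⊆ W →
    ∀ {f g : UForm I M F}, (∀ k, ∀ x ∈ W, (f k).SmoothAt x) → (∀ k, ∀ x ∈ W, (g k).SmoothAt x) →
      r J (f - g) = r J f - r J g
  /-- restriction of ambient forms commutes with `d` -/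
  r_D : ∀ ⦃p : ℕ⦄ (J : Fin (p + 1) → ι) {W : Set M}, IsOpen W → (⋂ m, K (J m)) ⊆ W →
    ∀ {f : UForm I M F}, UForm.IsSmoothOn W f → r J (UForm.D W f) = d J (r J f)
  /-- restriction of ambient forms is local near the stratum -/
  r_local : ∀ ⦃p : ℕ⦄ (J : Fin (p + 1) → ι) {W : Set M}, IsOpen W → (⋂ m, K (J m)) ⊆ W →
    ∀ {f g : UForm I M F}, (∀ k, ∀ x ∈ W, f k x = g k x) → r J f = r J g
  /-- tautness I: a closed form near `K_J` restricting to a boundary is exact near `K_J` -/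
  taut₁ : ∀ ⦃p : ℕ⦄ (J : Fin (p + 1) → ι) {W : Set M}, IsOpen W → (⋂ m, K (J m)) ⊆ W →
    ∀ {f : UForm I M F}, UForm.IsSmoothOn W f → UForm.D W f = 0 → (∃ ζ, r J f = d J ζ) →
      ∃ W' : Set M, IsOpen W' ∧ (⋂ m, K (J m)) ⊆ W' ∧ W' ⊆ W ∧ UForm.IsExactOn W' (UForm.restr W' f)
  /-- tautness II: every cycle of the stratum is a restricted closed form up to a boundary -/
  taut₂ : ∀ ⦃p : ℕ⦄ (J : Fin (p + 1) → ι) {W : Set M}, IsOpen W → (⋂ m, K (J m)) ⊆ W →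
    ∀ {ζ : T J}, d J ζ = 0 → ∃ W' : Set M, IsOpen W' ∧ (⋂ m, K (J m)) ⊆ W' ∧ W' ⊆ W ∧
      ∃ f : UForm I M F, UForm.IsSmoothOn W' f ∧ UForm.D W' f = 0 ∧ ∃ ε : T J, r J f = ζ + d J ε

namespace GermCechSystem

attribute [instance] GermCechSystem.instAddCommGroup GermCechSystem.instModule

variable {ι : Type*} (S : GermCechSystem.{w} I M F ι)

/-! #### Congruences for `res` -/

/-- Congruence of `res` in the map of tuples. [folklore] -/
theorem res_congr_θ {p q : ℕ} {J' : Fin p → ι} (J : Fin q → ι) {θ₁ θ₂ : Fin p → Fin q} (e : θ₁ = θ₂)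
    (h₁ : J' = J ∘ θ₁) (h₂ : J' = J ∘ θ₂) (z : S.T J') : S.res J' J θ₁ h₁ z = S.res J' J θ₂ h₂ z := by
  subst e; rfl

/-- Congruence of `res` applied to a SECTION `c` in the source tuple and the map. [folklore] -/
theorem res_congr {p q : ℕ} (c : ∀ J : Fin p → ι, S.T J) {J₁ J₂ : Fin p → ι} (J : Fin q → ι)
    {θ₁ θ₂ : Fin p → Fin q} (eJ : J₁ = J₂) (eθ : θ₁ = θ₂) (h₁ : J₁ = J ∘ θ₁) (h₂ : J₂ = J ∘ θ₂) :
    S.res J₁ J θ₁ h₁ (c J₁) = S.res J₂ J θ₂ h₂ (c J₂) := by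
  subst eJ; subst eθ; rfl

/-- Restriction of a section along (a map equal to) the identity between equal tuples. [folklore] -/
theorem res_section_self {p : ℕ} (c : ∀ J : Fin p → ι, S.T J) {J' J : Fin p → ι} (e : J' = J)
    (θ : Fin p → Fin p) (hθ : θ = id) (h : J' = J ∘ θ) : S.res J' J θ h (c J') = c J := by
  cases e
  exact S.res_self _ θ h hθ _

/-! #### The Čech differential -/

/-- **The full ordered Čech differential** `(δ c)_K = Σ_b (-1)^b c_{K ∘ σ_b}|_K` (Bott–Tu (8.4),
p. 93). [cite: BottTu1982Forms, §8 (8.4)] -/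
def cechδ {p : ℕ} (c : ∀ J : Fin (p + 1) → ι, S.T J) (K : Fin (p + 2) → ι) : S.T K :=
  ∑ b : Fin (p + 2), ((-1 : ℝ) ^ (b : ℕ)) •
    S.res (K ∘ Fin.succAbove b) K (Fin.succAbove b) rfl (c (K ∘ Fin.succAbove b))

/-- `δ` is additive. [folklore] -/
theorem cechδ_add {p : ℕ} (c c' : ∀ J : Fin (p + 1) → ι, S.T J) (K : Fin (p + 2) → ι) :
    S.cechδ (fun J ↦ c J + c' J) K = S.cechδ c K + S.cechδ c' K := by
  simp only [cechδ, map_add, smul_add, Finset.sum_add_distrib]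

/-- `δ` respects subtraction. [folklore] -/
theorem cechδ_sub {p : ℕ} (c c' : ∀ J : Fin (p + 1) → ι, S.T J) (K : Fin (p + 2) → ι) :
    S.cechδ (fun J ↦ c J - c' J) K = S.cechδ c K - S.cechδ c' K := by
  simp only [cechδ, map_sub, smul_sub, Finset.sum_sub_distrib]

/-- `δ` respects negation. [folklore] -/
theorem cechδ_neg {p : ℕ} (c : ∀ J : Fin (p + 1) → ι, S.T J) (K : Fin (p + 2) → ι) :
    S.cechδ (fun J ↦ -c J) K = -S.cechδ c K := by
  simp only [cechδ, map_neg, smul_neg, Finset.sum_neg_distrib]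

/-- `δ` is homogeneous. [folklore] -/
theorem cechδ_smul {p : ℕ} (a : ℝ) (c : ∀ J : Fin (p + 1) → ι, S.T J) (K : Fin (p + 2) → ι) :
    S.cechδ (fun J ↦ a • c J) K = a • S.cechδ c K := by
  simp only [cechδ, map_smul, Finset.smul_sum, smul_comm a]

/-- The Čech differential of the restriction of ONE ambient form (smooth near the two pieces) to
all `1`-strata vanishes on the `2`-tuple (`f|_{K₁}|_{K₀₁} - f|_{K₀}|_{K₀₁} = 0`).
[cite: BottTu1982Forms, Prop. 8.5] -/
theorem cechδ_r_zero {W : Set M} (hW : IsOpen W) (K : Fin 2 → ι) (h0 : S.K (K 0) ⊆ W)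
    (h1 : S.K (K 1) ⊆ W) {f : UForm I M F} (hf : ∀ k, ∀ x ∈ W, (f k).SmoothAt x) :
    S.cechδ (fun J : Fin 1 → ι ↦ S.r J f) K = 0 := by
  have hface : ∀ b : Fin 2, (⋂ m, S.K ((K ∘ Fin.succAbove b) m)) ⊆ W := by
    intro b
    refine (iInter_subset _ 0).trans ?_
    fin_cases b
    · exact h1
    · exact h0
  rw [cechδ, Fin.sum_univ_two]
  rw [S.res_r _ K _ rfl hW (hface 0) hf, S.res_r _ K _ rfl hW (hface 1) hf]
  simp only [Fin.val_zero, pow_zero, one_smul, Fin.val_one, pow_one, neg_one_smul, add_neg_cancel]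

/-! #### The link of a piece -/

/-- The strata indexed by tuples `a ∷ J` intersect `K_a`. [folklore] -/
theorem iInter_cons (a : ι) {p : ℕ} (J : Fin p → ι) :
    (⋂ m, S.K ((Fin.cons a J : Fin (p + 1) → ι) m)) = S.K a ∩ ⋂ m, S.K (J m) := by
  ext x
  simp only [mem_iInter, mem_inter_iff]
  constructor
  · intro h
    exact ⟨h 0, fun m ↦ h m.succ⟩
  · intro h m
    exact Fin.cases h.1 (fun j ↦ h.2 j) m

/-- **The link system at `a`**: pieces `K_a ∩ K_i`, strata modules `T'_J = T_{a ∷ J}`, restrictions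
lifted (`θ ↦ θ⁺`), `r'_J = r_{a ∷ J}`. [cite: BottTu1982Forms, §8] -/
abbrev link [T2Space M] (a : ι) : GermCechSystem.{w} I M F ι where
  K i := S.K a ∩ S.K i
  isCompact_K i := (S.isCompact_K i).inter_left (S.isCompact_K a).isClosed
  T _ J := S.T (Fin.cons a J)
  res _ _ J' J θ h := S.res (Fin.cons a J') (Fin.cons a J) (liftMap θ) (by rw [cons_comp_liftMap, h])
  d _ J := S.d (Fin.cons a J)
  r _ J := S.r (Fin.cons a J)
  res_self _ J θ h hθ z := S.res_self _ _ _ (by subst hθ; exact liftMap_id) z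
  res_res _ _ _ J'' J' J θ θ' h h' h'' z := by
    rw [S.res_res _ _ _ _ _ _ _ (by rw [← liftMap_comp, cons_comp_liftMap, h''])]
    exact S.res_congr_θ _ (liftMap_comp θ θ').symm _ _ z
  res_d _ _ J' J θ h z := S.res_d _ _ _ _ z
  res_r _ _ J' J θ h W hW hKW f hf := S.res_r _ _ _ _ hW (by rwa [S.iInter_cons, inter_iInter]) hf
  r_add _ J W hW hKW f g hf hg := S.r_add _ hW (by rwa [S.iInter_cons, inter_iInter]) hf hg
  r_sub _ J W hW hKW f g hf hg := S.r_sub _ hW (by rwa [S.iInter_cons, inter_iInter]) hf hg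
  r_D _ J W hW hKW f hf := S.r_D _ hW (by rwa [S.iInter_cons, inter_iInter]) hf
  r_local _ J W hW hKW f g hfg := S.r_local _ hW (by rwa [S.iInter_cons, inter_iInter]) hfg
  taut₁ _ J W hW hKW f hf hDf hζ := by
    obtain ⟨W', hW'o, hKW', hW'W, hex⟩ :=
      S.taut₁ _ hW (by rwa [S.iInter_cons, inter_iInter]) hf hDf hζ
    exact ⟨W', hW'o, by rwa [← inter_iInter, ← S.iInter_cons], hW'W, hex⟩
  taut₂ _ J W hW hKW ζ hζ := by
    obtain ⟨W', hW'o, hKW', hW'W, hex⟩ := S.taut₂ _ hW (by rwa [S.iInter_cons, inter_iInter]) hζ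
    exact ⟨W', hW'o, by rwa [← inter_iInter, ← S.iInter_cons], hW'W, hex⟩

section Link

variable [T2Space M] (a : ι)

/-- The pieces of the link system. [folklore] -/
@[simp] theorem link_K (i : ι) : (S.link a).K i = S.K a ∩ S.K i := rfl

/-- The strata modules of the link system. [folklore] -/
@[simp] theorem link_T {p : ℕ} (J : Fin p → ι) : (S.link a).T J = S.T (Fin.cons a J) := rfl

/-- The restrictions of the link system. [folklore] -/
theorem link_res {p q : ℕ} (J' : Fin p → ι) (J : Fin q → ι) (θ : Fin p → Fin q) (h : J' = J ∘ θ)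
    (z : S.T (Fin.cons a J')) :
    (S.link a).res J' J θ h z = S.res (Fin.cons a J') (Fin.cons a J) (liftMap θ)
      (by rw [cons_comp_liftMap, h]) z := rfl

/-- The differential of the link system. [folklore] -/
@[simp] theorem link_d {p : ℕ} (J : Fin p → ι) (z : S.T (Fin.cons a J)) :
    (S.link a).d J z = S.d (Fin.cons a J) z := rfl

/-- The ambient restriction of the link system. [folklore] -/
@[simp] theorem link_r {p : ℕ} (J : Fin p → ι) (f : UForm I M F) :
    (S.link a).r J f = S.r (Fin.cons a J) f := rfl

/-- **The Čech differential at `a ∷ K`**: `(δ C)_{a ∷ K} = C_K|_{a ∷ K} - (δ' C(a ∷ ·))_K`, where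
`δ'` is the Čech differential of the link system (split off the face `b = 0`; the faces `b + 1` of
`a ∷ K` are `a ∷ (faces of K)` with sign `-(-1)^b`). [cite: BottTu1982Forms, §8 (8.4)] -/
theorem cechδ_cons {q : ℕ} (C : ∀ J : Fin (q + 2) → ι, S.T J) (K : Fin (q + 2) → ι) :
    S.cechδ C (Fin.cons a K) =
      S.res K (Fin.cons a K) Fin.succ rfl (C K) -
        ((S.link a).cechδ (fun L : Fin (q + 1) → ι ↦ C (Fin.cons a L)) K : S.T (Fin.cons a K)) := by
  simp only [cechδ]
  conv_lhs => rw [Fin.sum_univ_succ]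
  rw [sub_eq_add_neg]
  congr 1
  · simp only [Fin.val_zero, pow_zero, one_smul]
    exact S.res_congr C (Fin.cons a K) rfl Fin.succAbove_zero rfl rfl
  · rw [← Finset.sum_neg_distrib]
    refine Finset.sum_congr rfl fun b _ ↦ ?_
    rw [Fin.val_succ, pow_succ, mul_neg_one, neg_smul]
    exact congrArg (fun z ↦ -(((-1 : ℝ) ^ (b : ℕ)) • z))
      (S.res_congr C (Fin.cons a K) (cons_comp_succAbove_succ a K b) (liftMap_succAbove b).symm rfl
        (cons_comp_liftMap a K (Fin.succAbove b)).symm)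

/-- **Restriction to the `a`-stratum commutes with the Čech differential**:
`(δ c)_K|_{a ∷ K} = δ' (c|_{a ∷ ·})_K`. [cite: BottTu1982Forms, §8 (8.4)] -/
theorem res_cechδ_eq_link_cechδ {q : ℕ} (c : ∀ J : Fin (q + 1) → ι, S.T J) (K : Fin (q + 2) → ι) :
    S.res K (Fin.cons a K) Fin.succ rfl (S.cechδ c K) =
      ((S.link a).cechδ (fun L : Fin (q + 1) → ι ↦ S.res L (Fin.cons a L) Fin.succ rfl (c L)) K :
        S.T (Fin.cons a K)) := by
  simp only [cechδ, map_sum, map_smul]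
  refine Finset.sum_congr rfl fun b _ ↦ ?_
  have e1 : S.res K (Fin.cons a K) Fin.succ rfl
      (S.res (K ∘ Fin.succAbove b) K (Fin.succAbove b) rfl (c (K ∘ Fin.succAbove b))) =
      S.res (K ∘ Fin.succAbove b) (Fin.cons a K) (Fin.succ ∘ Fin.succAbove b) rfl
        (c (K ∘ Fin.succAbove b)) :=
    S.res_res (K ∘ Fin.succAbove b) K (Fin.cons a K) Fin.succ (Fin.succAbove b) rfl rfl rfl _
  have e2 : (S.link a).res (K ∘ Fin.succAbove b) K (Fin.succAbove b) rfl
      (S.res (K ∘ Fin.succAbove b) (Fin.cons a (K ∘ Fin.succAbove b)) Fin.succ rfl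
        (c (K ∘ Fin.succAbove b))) =
      S.res (K ∘ Fin.succAbove b) (Fin.cons a K) (Fin.succ ∘ Fin.succAbove b) rfl
        (c (K ∘ Fin.succAbove b)) :=
    S.res_res (K ∘ Fin.succAbove b) (Fin.cons a (K ∘ Fin.succAbove b)) (Fin.cons a K)
      (liftMap (Fin.succAbove b)) Fin.succ (cons_comp_liftMap a K (Fin.succAbove b)).symm rfl rfl _
  rw [e1, e2]

omit [T2Space M] in
/-- **Restriction from the `1`-stratum `[a]` to a stratum `a ∷ L`** (along `0 ↦ 0`). [folklore] -/
def resHead {p : ℕ} (L : Fin p → ι) : S.T (fun _ : Fin 1 ↦ a) →ₗ[ℝ] S.T (Fin.cons a L) :=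
  S.res (fun _ : Fin 1 ↦ a) (Fin.cons a L) (fun _ ↦ 0) rfl

omit [T2Space M] in
/-- Unfolding of `resHead`. [folklore] -/
theorem resHead_apply {p : ℕ} (L : Fin p → ι) (z : S.T (fun _ : Fin 1 ↦ a)) :
    S.resHead a L z = S.res (fun _ : Fin 1 ↦ a) (Fin.cons a L) (fun _ ↦ 0) rfl z := rfl

/-- Restricting further along the link does not change the restriction from `[a]`. [folklore] -/
theorem link_res_resHead {p q : ℕ} (K : Fin q → ι) (θ : Fin p → Fin q) (z : S.T (fun _ : Fin 1 ↦ a)) :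
    (S.link a).res (K ∘ θ) K θ rfl (S.resHead a (K ∘ θ) z) = S.resHead a K z := by
  rw [resHead_apply, resHead_apply]
  exact (S.res_res (fun _ : Fin 1 ↦ a) (Fin.cons a (K ∘ θ)) (Fin.cons a K) (liftMap θ) (fun _ ↦ 0)
    (cons_comp_liftMap a K θ).symm rfl rfl z).trans (S.res_congr_θ _ (funext fun _ ↦ rfl) _ _ z)

end Link

/-! ### §4 The descent theorem -/

section Descent

variable [T2Space M] [IsManifold I ∞ M] [FiniteDimensional ℝ E] [SecondCountableTopology M]
  [LinearOrder ι]

omit [T2Space M] [IsManifold I ∞ M] [FiniteDimensional ℝ E] [SecondCountableTopology M] [LinearOrder ι] in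
/-- **One piece**: near a single compact stratum `K_a`, a closed form whose restriction to the
stratum is `d η₀` is exact, `α = D τ`, with `r τ = η₀ + d ε` (tautness I to make `α` exact, tautness
II to correct the primitive by a closed form). [cite: Spanier1981, Ch. 6 §1 Thm. 10] -/
theorem exists_single (S : GermCechSystem.{w} I M F ι) (A : Fin 1 → ι) {W : Set M} (hW : IsOpen W)
    (hKW : S.K (A 0) ⊆ W) {α : UForm I M F} (hα : UForm.IsSmoothOn W α) (hdα : UForm.D W α = 0)
    (η₀ : S.T A) (h0 : S.d A η₀ = S.r A α) :
    ∃ V : Set M, IsOpen V ∧ S.K (A 0) ⊆ V ∧ V ⊆ W ∧ ∃ τ : UForm I M F, UForm.IsSmoothOn V τ ∧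
      UForm.D V τ = UForm.restr V α ∧ ∃ ε : S.T A, S.r A τ = η₀ + S.d A ε := by
  have hKA : (⋂ m, S.K (A m)) = S.K (A 0) := by
    ext x; simp only [mem_iInter]; exact ⟨fun h ↦ h 0, fun h m ↦ by rwa [Subsingleton.elim m 0]⟩
  -- tautness I: `α` is exact near `K_a`
  obtain ⟨W₁, hW₁o, hKW₁, hW₁W, τ₀, hτ₀, hDτ₀⟩ :=
    S.taut₁ A hW (by rwa [hKA]) hα hdα ⟨η₀, h0.symm⟩
  rw [hKA] at hKW₁
  -- the discrepancy `r τ₀ - η₀` is a cycle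
  have hζ : S.d A (S.r A τ₀ - η₀) = 0 := by
    rw [map_sub, ← S.r_D A hW₁o (by rwa [hKA]) hτ₀, hDτ₀, h0, sub_eq_zero]
    exact S.r_local A hW₁o (by rwa [hKA]) fun k x hx ↦ UForm.restr_apply_of_mem α k hx
  -- tautness II: it is a restricted closed form up to a boundary
  obtain ⟨W₂, hW₂o, hKW₂, hW₂W₁, f₂, hf₂, hDf₂, ε₂, hε₂⟩ := S.taut₂ A hW₁o (by rwa [hKA]) hζ
  rw [hKA] at hKW₂
  refine ⟨W₂, hW₂o, hKW₂, hW₂W₁.trans hW₁W, UForm.restr W₂ τ₀ - f₂,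
    (hτ₀.restr hW₂o hW₂W₁).sub hf₂, ?_, -ε₂, ?_⟩
  · rw [UForm.D_sub (fun k x hx ↦ (hτ₀.restr hW₂o hW₂W₁).smoothAt k hx)
        (fun k x hx ↦ hf₂.smoothAt k hx),
      hDf₂, sub_zero, UForm.D_restr_self hW₂o, ← UForm.restr_D_of_subset hW₂W₁, hDτ₀,
      UForm.restr_restr_of_subset hW₂W₁]
  · rw [S.r_sub A hW₂o (by rwa [hKA]) (fun k x hx ↦ (hτ₀.restr hW₂o hW₂W₁).smoothAt k hx)
        (fun k x hx ↦ hf₂.smoothAt k hx), hε₂, map_neg,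
      S.r_local A hW₂o (by rwa [hKA]) (fun k x hx ↦ UForm.restr_apply_of_mem τ₀ k hx)]
    abel

omit [SecondCountableTopology M] in
/-- Two compact sets and an open set containing their intersection: enlarge to open neighbourhoods
meeting only inside it. [folklore] -/
theorem exists_open_inter_subset {Ka K' V'' : Set M} (hKa : IsCompact Ka) (hK' : IsCompact K')
    (hV'' : IsOpen V'') (h : Ka ∩ K' ⊆ V'') :
    ∃ Oa O' : Set M, IsOpen Oa ∧ IsOpen O' ∧ Ka ⊆ Oa ∧ K' ⊆ O' ∧ Oa ∩ O' ⊆ V'' := by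
  have hd : Disjoint (Ka \ V'') (K' \ V'') := by
    rw [Set.disjoint_left]
    rintro x ⟨hxa, hxV⟩ ⟨hx', -⟩
    exact hxV (h ⟨hxa, hx'⟩)
  obtain ⟨U₁, U₂, hU₁, hU₂, h₁, h₂, hdisj⟩ :=
    SeparatedNhds.of_isCompact_isCompact (hKa.diff hV'') (hK'.diff hV'') hd
  refine ⟨U₁ ∪ V'', U₂ ∪ V'', hU₁.union hV'', hU₂.union hV'', fun x hx ↦ ?_, fun x hx ↦ ?_, ?_⟩
  · by_cases hxV : x ∈ V''
    · exact Or.inr hxV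
    · exact Or.inl (h₁ ⟨hx, hxV⟩)
  · by_cases hxV : x ∈ V''
    · exact Or.inr hxV
    · exact Or.inl (h₂ ⟨hx, hxV⟩)
  · rintro x ⟨hx₁ | hx₁, hx₂ | hx₂⟩
    · exact absurd hx₂ (Set.disjoint_left.1 hdisj hx₁)
    · exact hx₂
    · exact hx₁
    · exact hx₁

/-- **Germ Čech descent, with coherence data.** For a finite set `s` of indices, a closed
(ungraded) form `α` on an open `W ⊇ ⋃_{i ∈ s} K_i`, and a TOWER `η` over `s` — `d η₀(J) = r_J α` on
admissible `1`-tuples and `δ η_q = d η_{q+1}` on admissible `(q+2)`-tuples — there are an open `V`,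
`⋃_{i∈s} K_i ⊆ V ⊆ W`, a form `τ` on `V` with `D_V τ = α|_V`, and cochains `ε` exhibiting `(α, η)` as
the coboundary of `(τ, ε)`: `r_J τ = η₀(J) + d ε₀(J)`, `η_{q+1}(K) = -δ ε_q(K) - d ε_{q+1}(K)`.
Induction on `s` removing its minimum `a`: the pieces over `s ∖ {a}` (induction), the piece `K_a`
(`exists_single`), the difference of the two primitives near `K_a ∩ ⋃ K_i` handled by the induction
hypothesis applied to the LINK system with the shifted tower, and a two-set gluing with a bump pair
(Bott–Tu Prop. 2.3 and §8; Lee pp. 449–450). [cite: BottTu1982Forms, Prop. 8.5 and Prop. 8.8] -/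
theorem exists_isExactOn_of_tower (s : Finset ι) :
    ∀ (S : GermCechSystem.{w} I M F ι) {W : Set M}, IsOpen W → (∀ i ∈ s, S.K i ⊆ W) →
    ∀ {α : UForm I M F}, UForm.IsSmoothOn W α → UForm.D W α = 0 →
    ∀ (η : ∀ q : ℕ, ∀ J : Fin (q + 1) → ι, S.T J),
    (∀ J : Fin 1 → ι, Adm s J → S.d J (η 0 J) = S.r J α) →
    (∀ (q : ℕ) (K : Fin (q + 2) → ι), Adm s K → S.cechδ (η q) K = S.d K (η (q + 1) K)) →
    ∃ V : Set M, IsOpen V ∧ (∀ i ∈ s, S.K i ⊆ V) ∧ V ⊆ W ∧ ∃ τ : UForm I M F, UForm.IsSmoothOn V τ ∧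
      UForm.D V τ = UForm.restr V α ∧
      ∃ ε : ∀ q : ℕ, ∀ J : Fin (q + 1) → ι, S.T J,
        (∀ J : Fin 1 → ι, Adm s J → S.r J τ = η 0 J + S.d J (ε 0 J)) ∧
        (∀ (q : ℕ) (K : Fin (q + 2) → ι), Adm s K →
          η (q + 1) K = -S.cechδ (ε q) K - S.d K (ε (q + 1) K)) := by
  classical
  induction s using Finset.induction_on_min with
  | empty =>
    intro S W hW _ α _ _ η _ _
    refine ⟨∅, isOpen_empty, fun i hi ↦ absurd hi (Finset.notMem_empty i), empty_subset W, 0,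
      UForm.isSmoothOn_zero ∅, by rw [UForm.D_zero, UForm.restr_empty], fun _ _ ↦ 0, ?_, ?_⟩
    · intro J hJ; exact absurd ((adm_one_iff ∅ J).1 hJ) (Finset.notMem_empty _)
    · intro q K hK; exact absurd (hK.2 0) (Finset.notMem_empty _)
  | insert a s' ha IH =>
    intro S W hW hKW α hα hdα η h0 hsucc
    have hsub : s' ⊆ insert a s' := Finset.subset_insert a s'
    -- (1) the pieces over `s'`
    obtain ⟨V', hV'o, hKV', hV'W, τ', hτ', hDτ', ε', hε'0, hε'succ⟩ :=
      IH S hW (fun i hi ↦ hKW i (hsub hi)) hα hdα η (fun J hJ ↦ h0 J (hJ.mono hsub))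
        (fun q K hK ↦ hsucc q K (hK.mono hsub))
    -- (2) the piece `K_a`
    set A : Fin 1 → ι := fun _ ↦ a with hA
    have hAdmA : Adm (insert a s') A := (adm_one_iff _ A).2 (Finset.mem_insert_self a s')
    have hKA : (⋂ m, S.K (A m)) = S.K (A 0) := by
      ext x; simp only [mem_iInter]; exact ⟨fun h ↦ h 0, fun h m ↦ by rwa [Subsingleton.elim m 0]⟩
    obtain ⟨Va, hVao, hKVa, hVaW, τa, hτa, hDτa, εa, hεa⟩ :=
      S.exists_single A hW (hKW a (Finset.mem_insert_self a s')) hα hdα (η 0 A) (h0 A hAdmA)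
    -- (3) the difference of the primitives near `K_a ∩ ⋃ K_i`, as a datum for the link system
    set W₀ : Set M := Va ∩ V' with hW₀
    have hW₀o : IsOpen W₀ := hVao.inter hV'o
    set θ : UForm I M F := UForm.restr W₀ τ' - UForm.restr W₀ τa with hθdef
    have hθs : UForm.IsSmoothOn W₀ θ :=
      (hτ'.restr hW₀o inter_subset_right).sub (hτa.restr hW₀o inter_subset_left)
    have hDθ : UForm.D W₀ θ = 0 := by
      rw [hθdef, UForm.D_sub (fun k x hx ↦ (hτ'.restr hW₀o inter_subset_right).smoothAt k hx)
        (fun k x hx ↦ (hτa.restr hW₀o inter_subset_left).smoothAt k hx),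
        UForm.D_restr_self hW₀o, UForm.D_restr_self hW₀o,
        ← UForm.restr_D_of_subset (inter_subset_right : W₀ ⊆ V'),
        ← UForm.restr_D_of_subset (inter_subset_left : W₀ ⊆ Va), hDτ', hDτa,
        UForm.restr_restr_of_subset inter_subset_right, UForm.restr_restr_of_subset inter_subset_left,
        sub_self]
    -- the shifted tower: `η'_q(L) = (-1)^q (η_{q+1}(a ∷ L) + ε'_q(L)|) - [q = 0] ε_a|`
    set μ : ∀ q : ℕ, ∀ L : Fin (q + 1) → ι, S.T (Fin.cons a L) := fun q ↦
      match q with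
      | 0 => fun L ↦ S.resHead a L εa
      | _ + 1 => fun _ ↦ 0 with hμ
    set η' : ∀ q : ℕ, ∀ L : Fin (q + 1) → ι, S.T (Fin.cons a L) := fun q L ↦
      ((-1 : ℝ) ^ q) • (η (q + 1) (Fin.cons a L) + S.res L (Fin.cons a L) Fin.succ rfl (ε' q L)) -
        μ q L with hη'
    have hKW₀ : ∀ i ∈ s', (S.link a).K i ⊆ W₀ := fun i hi ↦
      subset_inter (inter_subset_left.trans hKVa) (inter_subset_right.trans (hKV' i hi))
    have h0' : ∀ L : Fin 1 → ι, Adm s' L → (S.link a).d L (η' 0 L) = (S.link a).r L θ := by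
      intro L hL
      have hcons : Adm (insert a s') (Fin.cons a L : Fin 2 → ι) := adm_cons ha hL
      have h1 := hsucc 0 (Fin.cons a L) hcons
      rw [cechδ, Fin.sum_univ_two] at h1
      simp only [Fin.val_zero, pow_zero, one_smul, Fin.val_one, pow_one, neg_one_smul] at h1
      -- the two faces of `a ∷ L` are `L` and `A`
      have hf0 : S.res ((Fin.cons a L : Fin 2 → ι) ∘ Fin.succAbove 0) (Fin.cons a L) (Fin.succAbove 0)
          rfl (η 0 ((Fin.cons a L : Fin 2 → ι) ∘ Fin.succAbove 0)) =
          S.res L (Fin.cons a L) Fin.succ rfl (η 0 L) :=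
        S.res_congr (η 0) (Fin.cons a L) rfl Fin.succAbove_zero rfl rfl
      have hf1 : S.res ((Fin.cons a L : Fin 2 → ι) ∘ Fin.succAbove 1) (Fin.cons a L) (Fin.succAbove 1)
          rfl (η 0 ((Fin.cons a L : Fin 2 → ι) ∘ Fin.succAbove 1)) =
          S.res A (Fin.cons a L) (fun _ ↦ 0) rfl (η 0 A) :=
        S.res_congr (η 0) (Fin.cons a L) (by rw [succAbove_one_eq]) succAbove_one_eq rfl rfl
      rw [hf0, hf1] at h1
      -- the restrictions of `τ'` and `τ_a` to the stratum `a ∷ L`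
      have hKL : (⋂ m, S.K ((Fin.cons a L : Fin 2 → ι) m)) ⊆ W₀ := by
        rw [S.iInter_cons]
        refine subset_inter (inter_subset_left.trans hKVa) ?_
        exact (inter_subset_right.trans (iInter_subset _ 0)).trans (hKV' _ ((adm_one_iff _ _).1 hL))
      have hrτ' : S.r (Fin.cons a L) (UForm.restr W₀ τ') =
          S.res L (Fin.cons a L) Fin.succ rfl (η 0 L) +
            S.d (Fin.cons a L) (S.res L (Fin.cons a L) Fin.succ rfl (ε' 0 L)) := by
        rw [S.r_local _ hW₀o hKL (fun k x hx ↦ UForm.restr_apply_of_mem τ' k hx),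
          ← S.res_r L (Fin.cons a L) Fin.succ rfl hV'o
            ((iInter_subset _ 0).trans (hKV' _ ((adm_one_iff _ _).1 hL))) (fun k x hx ↦ hτ'.smoothAt k hx),
          hε'0 L hL, map_add, S.res_d]
      have hrτa : S.r (Fin.cons a L) (UForm.restr W₀ τa) =
          S.res A (Fin.cons a L) (fun _ ↦ 0) rfl (η 0 A) +
            S.d (Fin.cons a L) (S.res A (Fin.cons a L) (fun _ ↦ 0) rfl εa) := by
        rw [S.r_local _ hW₀o hKL (fun k x hx ↦ UForm.restr_apply_of_mem τa k hx),
          ← S.res_r A (Fin.cons a L) (fun _ ↦ 0) rfl hVao (by rw [hKA]; exact hKVa)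
            (fun k x hx ↦ hτa.smoothAt k hx), hεa, map_add, S.res_d]
      change S.d (Fin.cons a L) (((-1 : ℝ) ^ 0) • (η 1 (Fin.cons a L) +
          S.res L (Fin.cons a L) Fin.succ rfl (ε' 0 L)) - S.res A (Fin.cons a L) (fun _ ↦ 0) rfl εa) =
        S.r (Fin.cons a L) θ
      rw [hθdef, S.r_sub (Fin.cons a L) hW₀o hKL
        (fun k x hx ↦ (hτ'.restr hW₀o inter_subset_right).smoothAt k hx)
        (fun k x hx ↦ (hτa.restr hW₀o inter_subset_left).smoothAt k hx),
        hrτ', hrτa, pow_zero, one_smul, map_sub, map_add, ← h1]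
      abel
    have hsucc' : ∀ (q : ℕ) (K : Fin (q + 2) → ι), Adm s' K →
        (S.link a).cechδ (η' q) K = (S.link a).d K (η' (q + 1) K) := by
      intro q K hK
      have hcons : Adm (insert a s') (Fin.cons a K : Fin (q + 3) → ι) := adm_cons ha hK
      -- `δ' (η_{q+1}(a ∷ ·)) = η_{q+1}(K)| - (δ η_{q+1})(a ∷ K) = η_{q+1}(K)| - d η_{q+2}(a ∷ K)`
      have hstar := S.cechδ_cons (a := a) (η (q + 1)) K
      rw [hsucc (q + 1) (Fin.cons a K) hcons] at hstar
      -- `η_{q+1}(K) = -δ ε'_q(K) - d ε'_{q+1}(K)` restricted to the `a`-stratum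
      have hres : S.res K (Fin.cons a K) Fin.succ rfl (η (q + 1) K) =
          -(S.link a).cechδ (fun L ↦ S.res L (Fin.cons a L) Fin.succ rfl (ε' q L)) K -
            S.d (Fin.cons a K) (S.res K (Fin.cons a K) Fin.succ rfl (ε' (q + 1) K)) := by
        rw [hε'succ q K hK, map_sub, map_neg, S.res_cechδ_eq_link_cechδ (a := a), S.res_d]
      -- the `μ`-term has vanishing link differential
      have hμδ : (S.link a).cechδ (μ q) K = 0 := by
        cases q with
        | zero =>
          change (S.link a).cechδ (fun L ↦ S.resHead a L εa) K = 0
          rw [cechδ, Fin.sum_univ_two]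
          simp only [Fin.val_zero, pow_zero, one_smul, Fin.val_one, pow_one, neg_one_smul]
          rw [S.link_res_resHead, S.link_res_resHead, add_neg_cancel]
        | succ q =>
          change (S.link a).cechδ (fun L ↦ (0 : S.T (Fin.cons a L))) K = 0
          simp only [cechδ, map_zero, smul_zero, Finset.sum_const_zero]
      have hμd : S.d (Fin.cons a K) (μ (q + 1) K) = 0 := by
        change S.d (Fin.cons a K) 0 = 0
        exact map_zero _
      -- assemble
      have hlin : (S.link a).cechδ (η' q) K =
          ((-1 : ℝ) ^ q) • ((S.link a).cechδ (fun L ↦ η (q + 1) (Fin.cons a L)) K +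
            (S.link a).cechδ (fun L ↦ S.res L (Fin.cons a L) Fin.succ rfl (ε' q L)) K) -
            (S.link a).cechδ (μ q) K := by
        rw [hη', (S.link a).cechδ_sub, (S.link a).cechδ_smul, (S.link a).cechδ_add]
      rw [hlin, hμδ, sub_zero]
      have hstar' : (S.link a).cechδ (fun L ↦ η (q + 1) (Fin.cons a L)) K =
          S.res K (Fin.cons a K) Fin.succ rfl (η (q + 1) K) -
            S.d (Fin.cons a K) (η (q + 2) (Fin.cons a K)) := by
        rw [hstar]; abel
      rw [hstar', hres]
      change _ = S.d (Fin.cons a K) (((-1 : ℝ) ^ (q + 1)) • (η (q + 2) (Fin.cons a K) +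
        S.res K (Fin.cons a K) Fin.succ rfl (ε' (q + 1) K)) - μ (q + 1) K)
      rw [map_sub, hμd, sub_zero, map_smul, map_add, pow_succ]
      module
    -- (4) the induction hypothesis for the link system
    obtain ⟨V'', hV''o, hKV'', hV''W₀, β, hβ, hDβ, ε'', hε''0, hε''succ⟩ :=
      IH (S.link a) hW₀o hKW₀ hθs hDθ η' h0' hsucc'
    -- (5) shrink and glue
    have hK's : IsCompact (⋃ i ∈ s', S.K i) := s'.isCompact_biUnion fun i _ ↦ S.isCompact_K i
    have hint : S.K a ∩ (⋃ i ∈ s', S.K i) ⊆ V'' := by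
      rintro x ⟨hxa, hx⟩
      simp only [mem_iUnion] at hx
      obtain ⟨i, hi, hxi⟩ := hx
      exact hKV'' i hi ⟨hxa, hxi⟩
    obtain ⟨Oa, O', hOao, hO'o, hKOa, hKO', hOO⟩ :=
      exists_open_inter_subset (S.isCompact_K a) hK's hV''o hint
    set P : Set M := Oa ∩ Va with hP
    set Q : Set M := O' ∩ V' with hQ
    have hPo : IsOpen P := hOao.inter hVao
    have hQo : IsOpen Q := hO'o.inter hV'o
    have hKaP : S.K a ⊆ P := subset_inter hKOa hKVa
    have hKQ : ∀ i ∈ s', S.K i ⊆ Q := fun i hi ↦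
      subset_inter ((subset_biUnion_of_mem (u := fun i ↦ S.K i) hi).trans hKO') (hKV' i hi)
    have hPQV'' : P ∩ Q ⊆ V'' := fun x hx ↦ hOO ⟨hx.1.1, hx.2.1⟩
    have hPQW₀ : P ∩ Q ⊆ W₀ := fun x hx ↦ ⟨hx.1.2, hx.2.2⟩
    obtain ⟨b⟩ := exists_bumpPair (I := I) hPo hQo
    set βPQ : UForm I M F := UForm.restr (P ∩ Q) β with hβPQ
    have hβPQs : UForm.IsSmoothOn (P ∩ Q) βPQ := hβ.restr (hPo.inter hQo) hPQV''
    set gQ : UForm I M F := UForm.restr P (b.ρQ • βPQ) with hgQ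
    set gP : UForm I M F := UForm.restr Q (b.ρP • βPQ) with hgP
    have hgQs : UForm.IsSmoothOn P gQ := fun k ↦ b.smul_restr_mem_left hPo (hβPQs k)
    have hgPs : UForm.IsSmoothOn Q gP := fun k ↦ b.smul_restr_mem_right hQo (hβPQs k)
    -- `gP + gQ = β` on `P ∩ Q`
    have hgsum : ∀ k, ∀ x ∈ P ∩ Q, (gP + gQ) k x = β k x := by
      intro k x hx
      change (UForm.restr Q (b.ρP • βPQ)) k x + (UForm.restr P (b.ρQ • βPQ)) k x = β k x
      rw [UForm.restr_apply_of_mem _ k hx.2, UForm.restr_apply_of_mem _ k hx.1, add_comm]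
      change (b.ρQ • βPQ k) x + (b.ρP • βPQ k) x = β k x
      rw [b.smul_add_smul_apply (Or.inl hx.1), hβPQ, UForm.restr_apply, MForm.restr_apply_of_mem _ hx]
    -- `D (gP + gQ) = θ` on `P ∩ Q`
    have hDg : UForm.D (P ∩ Q) gP + UForm.D (P ∩ Q) gQ =
        UForm.restr (P ∩ Q) τ' - UForm.restr (P ∩ Q) τa := by
      rw [← UForm.D_add (fun k x hx ↦ hgPs.smoothAt k hx.2) (fun k x hx ↦ hgQs.smoothAt k hx.1),
        UForm.D_congr (hPo.inter hQo) hgsum, ← UForm.D_restr_self (hPo.inter hQo),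
        ← UForm.restr_D_eq_D_restr (hPo.inter hQo) hPQV'', hDβ, UForm.restr_restr_of_subset hPQV'',
        hθdef, UForm.restr_sub, UForm.restr_restr_of_subset hPQW₀, UForm.restr_restr_of_subset hPQW₀]
    set u : UForm I M F := UForm.restr P τa + UForm.D P gQ with hu
    set v : UForm I M F := UForm.restr Q τ' - UForm.D Q gP with hv
    have hus : UForm.IsSmoothOn P u := (hτa.restr hPo inter_subset_right).add (hgQs.D hPo)
    have hvs : UForm.IsSmoothOn Q v := (hτ'.restr hQo inter_subset_right).sub (hgPs.D hQo)
    have huv : UForm.restr (P ∩ Q) u = UForm.restr (P ∩ Q) v := by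
      rw [hu, hv, UForm.restr_add, UForm.restr_sub, UForm.restr_restr_of_subset inter_subset_left,
        UForm.restr_restr_of_subset inter_subset_right, UForm.restr_D_of_subset inter_subset_left,
        UForm.restr_D_of_subset inter_subset_right]
      rw [← sub_eq_zero, ← sub_eq_zero.2 hDg]
      abel
    obtain ⟨τ, hτs, hτP, hτQ⟩ := UForm.exists_glue hPo hQo hus hvs huv
    have hVW : P ∪ Q ⊆ W :=
      union_subset (inter_subset_right.trans hVaW) (inter_subset_right.trans hV'W)
    -- `D τ = α` on `P ∪ Q`
    have hDτ : UForm.D (P ∪ Q) τ = UForm.restr (P ∪ Q) α := by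
      refine UForm.eq_of_restr_eq_of_restr_eq (UForm.restr_D_self _ _) (UForm.restr_restr_self _ _)
        ?_ ?_
      · rw [UForm.restr_restr_of_subset subset_union_left,
          UForm.restr_D_eq_D_restr hPo subset_union_left, hτP, hu,
          UForm.D_add (fun k x hx ↦ (hτa.restr hPo inter_subset_right).smoothAt k hx)
            (fun k x hx ↦ (hgQs.D hPo).smoothAt k hx), UForm.D_D hPo hgQs, add_zero,
          UForm.D_restr_self hPo, ← UForm.restr_D_of_subset (inter_subset_right : P ⊆ Va), hDτa,
          UForm.restr_restr_of_subset inter_subset_right]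
      · rw [UForm.restr_restr_of_subset subset_union_right,
          UForm.restr_D_eq_D_restr hQo subset_union_right, hτQ, hv,
          UForm.D_sub (fun k x hx ↦ (hτ'.restr hQo inter_subset_right).smoothAt k hx)
            (fun k x hx ↦ (hgPs.D hQo).smoothAt k hx), UForm.D_D hQo hgPs, sub_zero,
          UForm.D_restr_self hQo, ← UForm.restr_D_of_subset (inter_subset_right : Q ⊆ V'), hDτ',
          UForm.restr_restr_of_subset inter_subset_right]
    -- pointwise agreement of `τ` with `u` on `P` and with `v` on `Q`
    have hτu : ∀ k, ∀ x ∈ P, τ k x = u k x := fun k x hx ↦ by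
      have := congrArg (fun f : UForm I M F ↦ f k x) hτP
      simpa [UForm.restr_apply_of_mem _ k hx] using this
    have hτv : ∀ k, ∀ x ∈ Q, τ k x = v k x := fun k x hx ↦ by
      have := congrArg (fun f : UForm I M F ↦ f k x) hτQ
      simpa [UForm.restr_apply_of_mem _ k hx] using this
    -- (6) the coherence cochains
    set ε : ∀ q : ℕ, ∀ J : Fin (q + 1) → ι, S.T J := fun q ↦
      match q with
      | 0 => fun J ↦ if h : J 0 = a then
          S.res A J id (by funext m; rw [Subsingleton.elim m 0]; exact h.symm) εa + S.r J gQ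
        else ε' 0 J - S.r J gP
      | q + 1 => fun J ↦ if h : J 0 = a then
          ((-1 : ℝ) ^ q) • S.res (Fin.cons a (Fin.tail J)) J id
            (by conv_rhs => rw [Function.comp_id, ← Fin.cons_self_tail J, h]) (ε'' q (Fin.tail J))
        else ε' (q + 1) J with hε
    -- evaluation of `ε`
    have hε0_a : ∀ J : Fin 1 → ι, J 0 = a → ∀ hAJ : A = J ∘ id,
        ε 0 J = S.res A J id hAJ εa + S.r J gQ := by
      intro J hJ hAJ
      change (if h : J 0 = a then _ else _) = _
      rw [dif_pos hJ]
    have hε0_ne : ∀ J : Fin 1 → ι, J 0 ≠ a → ε 0 J = ε' 0 J - S.r J gP := by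
      intro J hJ
      change (if h : J 0 = a then _ else _) = _
      rw [dif_neg hJ]
    have hεsucc_a : ∀ (q : ℕ) (L : Fin (q + 1) → ι),
        ε (q + 1) (Fin.cons a L) = ((-1 : ℝ) ^ q) • ε'' q L := by
      intro q L
      have hc : (Fin.cons a L : Fin (q + 2) → ι) 0 = a := rfl
      change (if h : (Fin.cons a L : Fin (q + 2) → ι) 0 = a then _ else _) = _
      rw [dif_pos hc]
      congr 1
      exact S.res_self (Fin.cons a L) id _ rfl (ε'' q L)
    have hεsucc_ne : ∀ (q : ℕ) (J : Fin (q + 2) → ι), J 0 ≠ a → ε (q + 1) J = ε' (q + 1) J := by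
      intro q J hJ
      change (if h : J 0 = a then _ else _) = _
      rw [dif_neg hJ]
    refine ⟨P ∪ Q, hPo.union hQo, ?_, hVW, τ, hτs, hDτ, ε, ?_, ?_⟩
    · intro i hi
      rcases Finset.mem_insert.1 hi with rfl | hi
      · exact hKaP.trans subset_union_left
      · exact (hKQ i hi).trans subset_union_right
    · -- (O0)
      intro J hJ
      by_cases hJa : J 0 = a
      · have hAJ : A = J := by funext m; rw [Subsingleton.elim m 0]; exact hJa.symm
        have hKJ : (⋂ m, S.K (J m)) ⊆ P := by
          refine (iInter_subset _ 0).trans ?_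
          rw [hJa]
          exact hKaP
        rw [S.r_local J hPo hKJ hτu, hu,
          S.r_add J hPo hKJ (fun k x hx ↦ (hτa.restr hPo inter_subset_right).smoothAt k hx)
            (fun k x hx ↦ (hgQs.D hPo).smoothAt k hx), S.r_D J hPo hKJ hgQs,
          S.r_local J hPo hKJ (fun k x hx ↦ UForm.restr_apply_of_mem τa k hx),
          ← S.res_r A J id (by rw [hAJ]; rfl) hVao (by rw [hKA]; exact hKVa)
            (fun k x hx ↦ hτa.smoothAt k hx), hεa, map_add, S.res_d,
          S.res_section_self (η 0) hAJ id rfl (by rw [hAJ]; rfl), hε0_a J hJa (by rw [hAJ]; rfl), map_add]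
        abel
      · have hJ' : Adm s' J := adm_one_of_ne hJa hJ
        have hKJ : (⋂ m, S.K (J m)) ⊆ Q :=
          (iInter_subset _ 0).trans (hKQ _ ((adm_one_iff _ _).1 hJ'))
        rw [S.r_local J hQo hKJ hτv, hv,
          S.r_sub J hQo hKJ (fun k x hx ↦ (hτ'.restr hQo inter_subset_right).smoothAt k hx)
            (fun k x hx ↦ (hgPs.D hQo).smoothAt k hx), S.r_D J hQo hKJ hgPs,
          S.r_local J hQo hKJ (fun k x hx ↦ UForm.restr_apply_of_mem τ' k hx), hε'0 J hJ',
          hε0_ne J hJa, map_sub]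
        abel
    · -- (Oq)
      intro q K hK
      induction K using Fin.consCases with
      | _ j L =>
      by_cases hja : j = a
      · subst hja
        have hL : Adm s' L := adm_tail_of_cons hK
        cases q with
        | zero =>
          -- `K = [a, i]`
          have hKL : (⋂ m, S.K ((Fin.cons j L : Fin 2 → ι) m)) ⊆ P ∩ Q := by
            rw [S.iInter_cons]
            exact subset_inter (inter_subset_left.trans hKaP)
              ((inter_subset_right.trans (iInter_subset _ 0)).trans
                (hKQ _ ((adm_one_iff _ _).1 hL)))
          have h00 := hε''0 L hL
          -- unfold the link data in `h00`
          change S.r (Fin.cons j L) β = (((-1 : ℝ) ^ 0) • (η 1 (Fin.cons j L) +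
            S.res L (Fin.cons j L) Fin.succ rfl (ε' 0 L)) - S.res A (Fin.cons j L) (fun _ ↦ 0) rfl εa) +
            S.d (Fin.cons j L) (ε'' 0 L) at h00
          rw [pow_zero, one_smul] at h00
          rw [cechδ, Fin.sum_univ_two]
          simp only [Fin.val_zero, pow_zero, one_smul, Fin.val_one, pow_one, neg_one_smul]
          have hf0 : S.res ((Fin.cons j L : Fin 2 → ι) ∘ Fin.succAbove 0) (Fin.cons j L) (Fin.succAbove 0)
              rfl (ε 0 ((Fin.cons j L : Fin 2 → ι) ∘ Fin.succAbove 0)) =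
              S.res L (Fin.cons j L) Fin.succ rfl (ε 0 L) :=
            S.res_congr (ε 0) (Fin.cons j L) rfl Fin.succAbove_zero rfl rfl
          have hf1 : S.res ((Fin.cons j L : Fin 2 → ι) ∘ Fin.succAbove 1) (Fin.cons j L) (Fin.succAbove 1)
              rfl (ε 0 ((Fin.cons j L : Fin 2 → ι) ∘ Fin.succAbove 1)) =
              S.res A (Fin.cons j L) (fun _ ↦ 0) rfl (ε 0 A) :=
            S.res_congr (ε 0) (Fin.cons j L) (by rw [succAbove_one_eq]) succAbove_one_eq rfl rfl
          rw [hf0, hf1, hεsucc_a 0 L, pow_zero, one_smul]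
          have hL0 : L 0 ≠ j := ne_of_gt (ha _ ((adm_one_iff _ _).1 hL))
          rw [hε0_ne L hL0, hε0_a A rfl rfl, S.res_self A id rfl rfl, map_sub, map_add,
            S.res_r L (Fin.cons j L) Fin.succ rfl hQo
              ((iInter_subset _ 0).trans (hKQ _ ((adm_one_iff _ _).1 hL))) (fun k x hx ↦ hgPs.smoothAt k hx),
            S.res_r A (Fin.cons j L) (fun _ ↦ 0) rfl hPo (by rw [hKA]; exact hKaP)
              (fun k x hx ↦ hgQs.smoothAt k hx)]
          have hrβ : S.r (Fin.cons j L) β = S.r (Fin.cons j L) gP + S.r (Fin.cons j L) gQ := by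
            rw [← S.r_add (Fin.cons j L) (hPo.inter hQo) hKL (fun k x hx ↦ hgPs.smoothAt k hx.2)
              (fun k x hx ↦ hgQs.smoothAt k hx.1)]
            exact (S.r_local _ (hPo.inter hQo) hKL hgsum).symm
          rw [hrβ] at h00
          rw [← sub_eq_zero, ← sub_eq_zero.2 h00.symm]
          abel
        | succ q =>
          -- `K = a ∷ L`, `L` of length `q + 2`
          have hOq := hε''succ q L hL
          change ((-1 : ℝ) ^ (q + 1)) • (η (q + 2) (Fin.cons j L) +
              S.res L (Fin.cons j L) Fin.succ rfl (ε' (q + 1) L)) - 0 =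
            -((S.link j).cechδ (ε'' q) L : S.T (Fin.cons j L)) - S.d (Fin.cons j L) (ε'' (q + 1) L) at hOq
          rw [sub_zero] at hOq
          rw [S.cechδ_cons (a := j) (ε (q + 1)) L, hεsucc_a (q + 1) L]
          have hL0 : L 0 ≠ j := ne_of_gt (ha _ (hL.2 0))
          rw [hεsucc_ne q L hL0]
          have hlink : (S.link j).cechδ (fun L' : Fin (q + 1) → ι ↦ ε (q + 1) (Fin.cons j L')) L =
              ((-1 : ℝ) ^ q) • (S.link j).cechδ (ε'' q) L := by
            rw [← (S.link j).cechδ_smul]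
            congr 1
            funext L'
            exact hεsucc_a q L'
          rw [hlink, map_smul]
          -- solve for `η (q+2) (a ∷ L)` from `hOq`
          have hsolve : η (q + 2) (Fin.cons j L) =
              -S.res L (Fin.cons j L) Fin.succ rfl (ε' (q + 1) L) +
                ((-1 : ℝ) ^ q) • ((S.link j).cechδ (ε'' q) L + S.d (Fin.cons j L) (ε'' (q + 1) L)) := by
            have h2 := congrArg (fun z ↦ ((-1 : ℝ) ^ (q + 1)) • z) hOq
            simp only [smul_sub, smul_add, smul_smul, ← pow_add, smul_neg] at h2
            rw [show q + 1 + (q + 1) = 2 * (q + 1) by ring, pow_mul, neg_one_sq, one_pow, one_smul] at h2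
            rw [← sub_eq_zero, ← sub_eq_zero.2 h2, pow_succ]
            module
          rw [hsolve]
          module
      · -- `K = j ∷ L` with `j ≠ a`: everything over `s'`
        have hK' : Adm s' (Fin.cons j L : Fin (q + 2) → ι) := adm_of_cons_ne ha hja hK
        cases q with
        | zero =>
          have hO := hε'succ 0 (Fin.cons j L) hK'
          rw [hO, hεsucc_ne 0 _ (by simpa using hja)]
          congr 1
          -- `δ ε₀ = δ ε'₀` on `j ∷ L`: the extra restricted-form cochain has zero differential
          have hfaces : ∀ bb : Fin 2, ε 0 ((Fin.cons j L : Fin 2 → ι) ∘ Fin.succAbove bb) =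
              ε' 0 ((Fin.cons j L : Fin 2 → ι) ∘ Fin.succAbove bb) -
                S.r ((Fin.cons j L : Fin 2 → ι) ∘ Fin.succAbove bb) gP := by
            intro bb
            refine hε0_ne _ ?_
            fin_cases bb
            · change L 0 ≠ a
              exact ne_of_gt (ha _ (hK'.2 1))
            · simpa using hja
          have : S.cechδ (ε 0) (Fin.cons j L) = S.cechδ (fun J ↦ ε' 0 J - S.r J gP) (Fin.cons j L) := by
            simp only [cechδ]
            exact Finset.sum_congr rfl fun bb _ ↦ by rw [hfaces bb]
          rw [this, S.cechδ_sub, S.cechδ_r_zero hQo (Fin.cons j L)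
            (hKQ _ (by simpa using hK'.2 0)) (hKQ _ (hK'.2 1)) (fun k x hx ↦ hgPs.smoothAt k hx), sub_zero]
        | succ q =>
          have hO := hε'succ (q + 1) (Fin.cons j L) hK'
          rw [hO, hεsucc_ne (q + 1) _ (by simpa using hja)]
          congr 2
          simp only [cechδ]
          refine Finset.sum_congr rfl fun bb _ ↦ ?_
          rw [hεsucc_ne q _ ?_]
          refine Fin.cases ?_ (fun b' ↦ ?_) bb
          · change L 0 ≠ a
            exact ne_of_gt (ha _ (hK'.2 1))
          · change (Fin.cons j L : Fin (q + 3) → ι) (Fin.succAbove b'.succ 0) ≠ a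
            rw [Fin.succAbove_ne_zero_zero (Fin.succ_ne_zero b')]
            simpa using hja

/-- **Germ Čech descent** (the statement used downstream): for a germ Čech system, a finite set
`s` of indices, a closed ungraded form `α` on an open `W ⊇ ⋃_{i∈s} K_i`, and a tower `η` over `s`
with `d η₀ = r α`, `δ η_q = d η_{q+1}` on admissible tuples, there is an open `V` with
`⋃_{i∈s} K_i ⊆ V ⊆ W` on which `α` is exact: `α|_V = D_V τ` for a form `τ` on `V`. (Generalized
Mayer–Vietoris principle for the closed cover by the strata, at the level of germs.)
[cite: BottTu1982Forms, Prop. 8.5 and Prop. 8.8] [cite: DeligneGriffithsMorganSullivan1975, §6] -/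
theorem exists_isExactOn (S : GermCechSystem.{w} I M F ι) (s : Finset ι) {W : Set M} (hW : IsOpen W)
    (hKW : ∀ i ∈ s, S.K i ⊆ W) {α : UForm I M F} (hα : UForm.IsSmoothOn W α) (hdα : UForm.D W α = 0)
    (η : ∀ q : ℕ, ∀ J : Fin (q + 1) → ι, S.T J)
    (h0 : ∀ J : Fin 1 → ι, Adm s J → S.d J (η 0 J) = S.r J α)
    (hsucc : ∀ (q : ℕ) (K : Fin (q + 2) → ι), Adm s K → S.cechδ (η q) K = S.d K (η (q + 1) K)) :
    ∃ V : Set M, IsOpen V ∧ (∀ i ∈ s, S.K i ⊆ V) ∧ V ⊆ W ∧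
      ∃ τ : UForm I M F, UForm.IsSmoothOn V τ ∧ UForm.D V τ = UForm.restr V α := by
  obtain ⟨V, hVo, hKV, hVW, τ, hτ, hDτ, -⟩ := exists_isExactOn_of_tower s S hW hKW hα hdα η h0 hsucc
  exact ⟨V, hVo, hKV, hVW, τ, hτ, hDτ⟩

end Descent

end GermCechSystem

end Literature.Geometry.Manifold

end
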